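import Literature.NumberTheory.EllipticCurves.Kim2025.StructureClauseOPEN
import Literature.NumberTheory.EllipticCurves.Rank1Residual.PeriodUnitProofs
import Summits.BirchSwinnertonDyer.Rank1Residual.X4.KimShaLength
import HarnessLib

/-!
# The BRIDGE from Kim 2025's own currency (integral periods of the modular symbols) to the cell's
# `Ω(W)`-normalised shapes: referee-1 ruling RA3 (ii) for team n1011 (cell `b2b-bsdres`, seat p09,
# OWNERS row T-a4; sibling of `Additive/X4SharpThreeKimLargeImage.lean`)

HONEST FRAMING (cell `b2b-bsdres`, run/shared/lean/b2b/bsd-rank1-residual/, verbatim in every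
file): the goal of the cell is to DELETE the COMBINATION-SHAPED residual classes of the
Birch–Swinnerton-Dyer formula for ALL analytic-rank `≤ 1` elliptic curves over `ℚ` — "full BSD
formula for every rank `≤ 1` curve in class `C`" assembled STRICTLY from published theorems — so
that the rank-`≤ 1` remainder becomes exactly the CONSTRUCTION-SHAPED classes, which are TYPED
(missing-input `Prop`s), NOT attempted. This is not "finishing BSD". Team n1011 (N10/N11, the X4 ∧
`p = 3` additive block) is a RESEARCH ROUTE; no claim beyond the stated classes; no label or mark is
changed by this file; nothing is booked. An ANNOUNCED preprint enters ONLY as an explicitly labelled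
OPEN hypothesis: every theorem below carrying `hK25v`/`hK25u : Kim2025.cor17_…_OPEN` is CONDITIONAL on
the unrefereed arXiv:2505.09121v1 (its `p = 3` Kolyvagin-system input, Sakamoto JTNB 36 (2024), is
refereed). Theorems only (no definition, no named fact minted here). FLAG `Kim2025-preprint`
(referee-1 ACK-1 T-a4, proviso 3) on EVERY theorem below taking a `Kim2025.…_OPEN` binder.

## What this file proves (referee 1, `cells/n1011/REFEREE-1.md` RA3 (ii))

The Literature file `Kim2025/LargeImageStructureOPEN` types Kim 2025 Cor. 1.7 twice: (A) in the
`Ω(W)`/Manin-datum shape of the published `p ≥ 5` tree facts (flag `Kim2025-OmegaE-integrality`: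
weaker-than-print MODULO the `p`-integrality of the `Ω(W)`-normalised symbols), and (V) in [K25]'s OWN
currency — `Kim2025.cor17_rankZero_padicValNat_sha_le_of_integralPeriod_OPEN`: for every exponent
`v` making `p^v·Ω⁺_f` an integral period (`v ≤ ord_p [r]⁺_f` for all `r` with `[r]⁺_f ≠ 0`),
`ord_p #Ш(E/ℚ)(p) ≤ ord_p [0]⁺_f − v`; and its unit form `…_sha_eq_of_kuriharaNumber_ne_zero_…`.
Here the bridge (V) ⟹ (A)-conclusion is PROVED under the two explicit binders that make the
currencies meet — the period transfer `Ω(W) = u·Ω⁺_f`, `|u|_p = 1` (tree facts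
`realPeriodRat_eq_unit_mul_plusPeriod[_three/_of_multiplicative]` where printed; the cell's
`X4.periodTransfer_of_optimal` for optimal parametrisations) and the `Ω⁺_f`-integrality of every
`[r]⁺_f` (`v = 0` admissible; for denominators prime to `N` a tree THEOREM under `E[p]` irreducible,
`IsNewformOf.norm_ratPlusSymbol_le_one`; for all cusps it is the large-image / Manin–Drinfeld
statement quoted in the Literature file) —:

* `rankZero_padicValNat_sha_le_of_integralPeriod_of_periodTransfer`: (V) + transfer + integrality ⟹
  `L(E,1)/Ω(W) = q ∈ ℚ` with `ord_p #Ш(E/ℚ)(p) ≤ ord_p q` — the conclusion of shape (A), no Manin datum;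
* `rankZero_padicValNat_shaOrder_le_of_integralPeriod_OPEN` / `X4RankZero.…`: hence `#Ш_an = q'` with
  `ord_p #Ш ≤ ord_p q' + ord_p ∏ c_ℓ (− 2 ord_p #E(ℚ)_tors)` — the X4♯-type inequality from (V);
* `bsdp_iff_not_dvd_tamagawaProduct_of_integralPeriod_OPEN_of_kuriharaUnit`: from the unit form of (V),
  the exact boundary `BSD(E,p) ⟺ p ∤ ∏ c_ℓ` (via additive-p3's fact-free
  `X4.bsdp_iff_not_dvd_tamagawaProduct_of_rankZero_witness`).

* `kimShaLengthAt_of_kim2025_OPEN` / `kimShaLengthRankZeroAt_of_kim2025_OPEN` (RA3 (iii)): the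
  general-rank clause `Kim2025.thm11_kimShaLength_of_integralPeriod_OPEN` (file
  `Kim2025/StructureClauseOPEN`) IS, pointwise, cc-typer-1's typed predicate `X4.KimShaLengthAt W p f`
  (`Summits/…/X4/KimShaLength.lean`), hence also its BSD-currency reading `X4.KimShaLengthRankZeroAt`
  under the period transfer — the bridge team n1011's `@[conjecture]` defs at `p = 3` consume.

So a consumer may feed EITHER currency; the `Ω(W)` shape costs exactly the period transfer + the
integrality, as the referee asked to be displayed. References: Kim 2025 [Kim2025RefinedTNC] Cor. 1.7,
§1.4.4, Def. 2.2, Rem. 2.3; Kim 2026 [Kim2022StructureSelmer] §1.4.1; Greenberg–Vatsal 2000 Rem. 3.4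
(period transfer); Miller 2011 [Miller2011LMS] Def. 1.1.
-/

noncomputable section

open scoped Classical MatrixGroups ModularForm

open CongruenceSubgroup WeierstrassCurve Literature.NumberTheory.EllipticCurves
  Literature.NumberTheory.EllipticCurves.ModularForms
  Literature.NumberTheory.EllipticCurves.Rank1Residual
  Literature.NumberTheory.EllipticCurves.Rank1Residual.Typed

namespace Summit.BirchSwinnertonDyer.Rank1Residual.Additive

variable (W : WeierstrassCurve ℚ) [W.IsElliptic] [W.IsGloballyMinimal] (p : ℕ) [hp : Fact p.Prime]

/-! ### §1 From integral periods to the `Ω(W)` shape -/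

omit [W.IsGloballyMinimal] in
/-- **Bookkeeping: `L(E,1)/Ω(W) = [0]⁺_f / u` under the period transfer `Ω(W) = u·Ω⁺_f`** (and
`[0]⁺_f·Ω⁺_f = L(E,1)`, `IsNewformOf.entireLFunction_one_eq`), with `ord_p([0]⁺_f/u) = ord_p [0]⁺_f`
when `|u|_p = 1`. Fact-free. [cite: GreenbergVatsal2000, §3, Remark 3.4] -/
theorem entireLFunction_one_div_realPeriodRat_eq_of_periodTransfer
    {N : ℕ} [NeZero N] {f : CuspForm (Gamma0 N) 2} (hf : IsNewformOf W f)
    {u : ℚ} (hu : ‖(u : ℚ_[p])‖ = 1) (hΩ : W.realPeriodRat = u * plusPeriod f) :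
    W.entireLFunction 1 / (W.realPeriodRat : ℂ) = ((ratPlusSymbol f 0 / u : ℚ) : ℂ) ∧
      padicValRat p (ratPlusSymbol f 0 / u) = padicValRat p (ratPlusSymbol f 0) := by
  have hu0 : u ≠ 0 := by
    rintro rfl
    simp at hu
  have hper : 0 < plusPeriod f := IsNewform0.plusPeriod_pos_holds hf.1 hf.coeffField_eq_bot
  constructor
  · rw [hf.entireLFunction_one_eq, hΩ]
    have hΩf : (plusPeriod f : ℂ) ≠ 0 := by exact_mod_cast hper.ne'
    have huC : ((u : ℝ) : ℂ) ≠ 0 := by exact_mod_cast hu0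
    push_cast
    field_simp
  · by_cases hs : ratPlusSymbol f 0 = 0
    · simp [hs]
    · rw [padicValRat.div hs hu0, padicValRat_eq_zero_of_norm_ratCast_eq_one hu, sub_zero]

/-- **The bridge (V) ⟹ (A)** (referee-1 RA3 (ii)): from Kim 2025 Cor. 1.7 in its own currency
(`hK25v`, OPEN), the period transfer `Ω(W) = u·Ω⁺_f` (`|u|_p = 1`) and the `Ω⁺_f`-integrality of every
plus symbol (`v = 0` admissible): `L(E,1)/Ω(W) = q ∈ ℚ` with `ord_p #Ш(E/ℚ)(p) ≤ ord_p q` — the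
conclusion of `Kim2025.rankZero_padicValNat_sha_le_of_towerSurj_OPEN` WITHOUT a Manin datum. CONDITIONAL
on the preprint. [claim: Kim2025RefinedTNC, status: under-review]
[cite: Kim2025RefinedTNC, Cor. 1.7, §1.4.4, Rem. 2.3 (ANNOUNCED, OPEN binder)] [cite: GreenbergVatsal2000, §3, Remark 3.4] -/
theorem rankZero_padicValNat_sha_le_of_integralPeriod_of_periodTransfer
    (hK25v : Kim2025.cor17_rankZero_padicValNat_sha_le_of_integralPeriod_OPEN)
    (hp3 : 3 ≤ p) (htower : ∀ n : ℕ, W.HasSurjectiveModNGaloisRep (p ^ n : ℕ))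
    (hL : W.entireLFunction 1 ≠ 0) (hfin : Finite W.sha)
    {N : ℕ} [NeZero N] {f : CuspForm (Gamma0 N) 2} (hf : IsNewformOf W f)
    (hper : ∃ u : ℚ, ‖(u : ℚ_[p])‖ = 1 ∧ W.realPeriodRat = u * plusPeriod f)
    (hint : ∀ r : ℚ, ratPlusSymbol f r ≠ 0 → 0 ≤ padicValRat p (ratPlusSymbol f r)) :
    ∃ q : ℚ, W.entireLFunction 1 / (W.realPeriodRat : ℂ) = (q : ℂ) ∧
      (padicValNat p (Nat.card (AddCommGroup.primaryComponent W.sha p)) : ℤ) ≤ padicValRat p q := by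
  obtain ⟨u, hu, hΩ⟩ := hper
  obtain ⟨hq, hv⟩ := entireLFunction_one_div_realPeriodRat_eq_of_periodTransfer W p hf hu hΩ
  refine ⟨ratPlusSymbol f 0 / u, hq, ?_⟩
  rw [hv]
  have h := hK25v W p hp3 htower hL hfin f hf 0 (fun r hr => hint r hr)
  simpa using h

/-- **`#Ш_an`-shape of the bridge, class-agnostic** (analytic rank `0`, `p ≥ 3`, tower, newform `f`,
period transfer, `Ω⁺_f`-integrality): `#Ш_an = q` with
`ord_p #Ш ≤ ord_p q + ord_p ∏ c_ℓ − 2 ord_p #E(ℚ)_tors`, CONDITIONAL on `hK25v` (OPEN); GZK `hGZK`,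
modularity `hmod`. [claim: Kim2025RefinedTNC, status: under-review]
[cite: Kim2025RefinedTNC, Cor. 1.7 (ANNOUNCED, OPEN binder)] [cite: Miller2011LMS, Def. 1.1] -/
theorem rankZero_padicValNat_shaOrder_le_of_integralPeriod_OPEN
    (hK25v : Kim2025.cor17_rankZero_padicValNat_sha_le_of_integralPeriod_OPEN)
    (hGZK : rank_eq_analyticRank_of_analyticRank_le_one) (hmod : hasEntireLFunction_rat)
    (hp3 : 3 ≤ p) (hr : W.analyticRank = 0)
    (htower : ∀ n : ℕ, W.HasSurjectiveModNGaloisRep (p ^ n : ℕ))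
    {N : ℕ} [NeZero N] {f : CuspForm (Gamma0 N) 2} (hf : IsNewformOf W f)
    (hper : ∃ u : ℚ, ‖(u : ℚ_[p])‖ = 1 ∧ W.realPeriodRat = u * plusPeriod f)
    (hint : ∀ r : ℚ, ratPlusSymbol f r ≠ 0 → 0 ≤ padicValRat p (ratPlusSymbol f r)) :
    ∃ q : ℚ, shaAn W = (q : ℂ) ∧
      (padicValNat p W.shaOrder : ℤ) ≤
        padicValRat p q + padicValNat p W.tamagawaProduct - 2 * padicValNat p W.torsionOrder := by
  have hL : W.entireLFunction 1 ≠ 0 := (W.analyticRank_eq_zero_iff_holds (hmod W)).mp hr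
  obtain ⟨hmw, hfin⟩ := hGZK W (by rw [hr]; exact zero_le_one)
  haveI : Finite W.sha := hfin
  have hmw0 : W.mordellWeilRank = 0 := by rw [hmw, hr]
  obtain ⟨q₀, hq₀, hle⟩ :=
    rankZero_padicValNat_sha_le_of_integralPeriod_of_periodTransfer W p hK25v hp3 htower hL hfin hf
      hper hint
  have hΩpos : 0 < W.realPeriodRat := W.realPeriodRat_pos_holds
  have hΩ : (W.realPeriodRat : ℂ) ≠ 0 := by exact_mod_cast hΩpos.ne'
  have hc0 : 0 < W.tamagawaProduct := W.tamagawaProduct_pos_holds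
  have ht0 : 0 < W.torsionOrder := W.torsionOrder_pos_holds
  have hq₀0 : q₀ ≠ 0 := by
    rintro rfl
    rw [Rat.cast_zero, div_eq_zero_iff] at hq₀
    exact hq₀.elim hL hΩ
  refine ⟨q₀ * (W.torsionOrder : ℚ) ^ 2 / (W.tamagawaProduct : ℚ), ?_, ?_⟩
  · have hcp : (W.tamagawaProduct : ℂ) ≠ 0 := by exact_mod_cast hc0.ne'
    have hLq : W.entireLFunction 1 = (q₀ : ℂ) * (W.realPeriodRat : ℂ) := by
      rw [← hq₀, div_mul_cancel₀ _ hΩ]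
    rw [shaAn_def, leadingLCoeff_eq_of_analyticRank_eq_zero W hr,
      W.regulator_eq_one_of_rank_zero hmw0, hLq]
    push_cast
    field_simp
  · have ht : (W.torsionOrder : ℚ) ≠ 0 := by exact_mod_cast ht0.ne'
    have hcq : (W.tamagawaProduct : ℚ) ≠ 0 := by exact_mod_cast hc0.ne'
    have hsha : padicValNat p (Nat.card (AddCommGroup.primaryComponent W.sha p)) =
        padicValNat p W.shaOrder := by
      unfold WeierstrassCurve.shaOrder
      exact padicValNat_card_addPrimaryComponent p
    have hv : padicValRat p (q₀ * (W.torsionOrder : ℚ) ^ 2 / (W.tamagawaProduct : ℚ)) =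
        padicValRat p q₀ + 2 * (padicValNat p W.torsionOrder : ℤ) -
          (padicValNat p W.tamagawaProduct : ℤ) := by
      rw [padicValRat.div (mul_ne_zero hq₀0 (pow_ne_zero 2 ht)) hcq,
        padicValRat.mul hq₀0 (pow_ne_zero 2 ht), pow_two, padicValRat.mul ht ht,
        padicValRat.of_nat, padicValRat.of_nat]
      ring
    rw [hv, ← hsha]
    linarith

/-- **X4 ∧ `r_an = 0` ∧ tower, from [K25]'s own currency**: `ord_p #Ш ≤ ord_p #Ш_an + ord_p ∏ c_ℓ`
given a newform `f` of `W` with the period transfer and `Ω⁺_f`-integral symbols — NO Manin datum.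
CONDITIONAL on `hK25v` (OPEN); the torsion term vanishes by irreducibility (Mazur 1977).
[claim: Kim2025RefinedTNC, status: under-review] [cite: Kim2025RefinedTNC, Cor. 1.7 (ANNOUNCED, OPEN binder)]
[cite: Mazur1977, Ch. III §5, p. 157] -/
theorem X4RankZero.padicValNat_shaOrder_le_of_integralPeriod_OPEN
    (hK25v : Kim2025.cor17_rankZero_padicValNat_sha_le_of_integralPeriod_OPEN)
    (hGZK : rank_eq_analyticRank_of_analyticRank_le_one) (hmod : hasEntireLFunction_rat)
    (hr : W.analyticRank = 0) (hX : ClassX4 W p)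
    (htower : ∀ n : ℕ, W.HasSurjectiveModNGaloisRep (p ^ n : ℕ))
    {N : ℕ} [NeZero N] {f : CuspForm (Gamma0 N) 2} (hf : IsNewformOf W f)
    (hper : ∃ u : ℚ, ‖(u : ℚ_[p])‖ = 1 ∧ W.realPeriodRat = u * plusPeriod f)
    (hint : ∀ r : ℚ, ratPlusSymbol f r ≠ 0 → 0 ≤ padicValRat p (ratPlusSymbol f r)) :
    ∃ q : ℚ, shaAn W = (q : ℂ) ∧
      (padicValNat p W.shaOrder : ℤ) ≤ padicValRat p q + padicValNat p W.tamagawaProduct := by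
  have hp3 : 3 ≤ p := by
    have h2 := hp.out.two_le
    have hne : p ≠ 2 := hX.1
    omega
  obtain ⟨q, hq, hle⟩ := rankZero_padicValNat_shaOrder_le_of_integralPeriod_OPEN W p hK25v hGZK hmod
    hp3 hr htower hf hper hint
  refine ⟨q, hq, ?_⟩
  rw [padicValNat_torsionOrder_eq_zero_of_irreducible W p hX.2.2] at hle
  simpa using hle

/-! ### §2 The unit form: the exact boundary from [K25]'s own currency -/

/-- **The exact boundary `BSD(E,p) ⟺ p ∤ ∏ c_ℓ` from ONE unit Kurihara number, in [K25]'s own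
currency** (`hK25u`, OPEN: `Ω⁺_f` integral + unit `kuriharaNumber f p n ψ` at a cyclic level ⟹
`ord_p #Ш(E/ℚ)(p) = ord_p [0]⁺_f`), bridged to Miller's `BSD(E,p)` under the period transfer
(`ord_p(L(E,1)/Ω(W)) = ord_p [0]⁺_f`) by additive-p3's fact-free
`X4.bsdp_iff_not_dvd_tamagawaProduct_of_rankZero_witness` (GZK; `E[p]` irreducible from the tower at
`n = 1`). Per pair. [claim: Kim2025RefinedTNC, status: under-review]
[cite: Kim2025RefinedTNC, Thm. 1.1 ("BSD"), Cor. 1.7 (ANNOUNCED, OPEN binder)] [cite: Miller2011LMS, Def. 1.1] -/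
theorem bsdp_iff_not_dvd_tamagawaProduct_of_integralPeriod_OPEN_of_kuriharaUnit
    (hK25u : Kim2025.cor17_rankZero_padicValRat_sha_eq_of_kuriharaNumber_ne_zero_of_integralPeriod_OPEN)
    (hGZK : rank_eq_analyticRank_of_analyticRank_le_one) (hp3 : 3 ≤ p)
    (htower : ∀ n : ℕ, W.HasSurjectiveModNGaloisRep (p ^ n : ℕ)) (hL : W.entireLFunction 1 ≠ 0)
    {N : ℕ} [NeZero N] {f : CuspForm (Gamma0 N) 2} (hf : IsNewformOf W f)
    (hper : ∃ u : ℚ, ‖(u : ℚ_[p])‖ = 1 ∧ W.realPeriodRat = u * plusPeriod f)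
    (hint : ∀ r : ℚ, ratPlusSymbol f r ≠ 0 → 0 ≤ padicValRat p (ratPlusSymbol f r))
    (n : ℕ) [NeZero n] (hn : Kato.IsKolyvaginProduct W p 1 n)
    (hcyc : ∀ (ℓ : ℕ) [Fact ℓ.Prime], ℓ ∣ n →
      Nat.card {P : ((WeierstrassCurve.integralModelInt W).map
          (Int.castRingHom (ZMod ℓ))).toAffine.Point // p • P = 0} ≤ p)
    (ψ : (ℓ : ℕ) → (ZMod ℓ)ˣ →* Multiplicative (ZMod (p ^ 1)))
    (hψ : ∀ ℓ ∈ n.primeFactors, Function.Surjective (ψ ℓ))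
    (hδ : kuriharaNumber f (p ^ 1) n ψ ≠ 0) : BSDp W p ↔ ¬ p ∣ W.tamagawaProduct := by
  have hr0 : W.analyticRank = 0 := analyticRank_eq_zero_of_entireLFunction_one_ne_zero hL
  obtain ⟨hmw, hfin⟩ := hGZK W (by rw [hr0]; exact zero_le_one)
  have heq := hK25u W p hp3 htower hL hfin f hf hint n hn hcyc ψ hψ hδ
  obtain ⟨u, hu, hΩ⟩ := hper
  obtain ⟨hq, hv⟩ := entireLFunction_one_div_realPeriodRat_eq_of_periodTransfer W p hf hu hΩ
  have hsurj : W.HasSurjectiveModNGaloisRep p := by simpa using htower 1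
  exact X4.bsdp_iff_not_dvd_tamagawaProduct_of_rankZero_witness W p hmw hfin hL
    (hasIrreducibleModPGaloisRep_of_hasSurjectiveModNGaloisRep W p hsurj) hq (by rw [hv, heq])

/-- **X4 ∧ `r_an = 0` ∧ tower ∧ `p ∤ ∏ c_ℓ`: `BSD(E,p)` from ONE unit Kurihara number in [K25]'s own
currency** (newform `f`, period transfer, `Ω⁺_f`-integral symbols, typed input `X4.KuriharaUnitAt W p f`),
whatever `ord_p #Ш_an` is — the LOWER@3 rows of N11 per pair, no Manin datum. CONDITIONAL on `hK25u`
(OPEN). [claim: Kim2025RefinedTNC, status: under-review]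
[cite: Kim2025RefinedTNC, Thm. 1.1, Cor. 1.7, §8.1.1 (ANNOUNCED, OPEN binder)] [cite: Miller2011LMS, Def. 1.1] -/
theorem X4RankZero.bsdp_of_integralPeriod_OPEN_of_kuriharaUnitAt
    (hK25u : Kim2025.cor17_rankZero_padicValRat_sha_eq_of_kuriharaNumber_ne_zero_of_integralPeriod_OPEN)
    (hGZK : rank_eq_analyticRank_of_analyticRank_le_one) (hmod : hasEntireLFunction_rat)
    (hr : W.analyticRank = 0) (hX : ClassX4 W p)
    (htower : ∀ n : ℕ, W.HasSurjectiveModNGaloisRep (p ^ n : ℕ))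
    {N : ℕ} [NeZero N] {f : CuspForm (Gamma0 N) 2} (hf : IsNewformOf W f)
    (hper : ∃ u : ℚ, ‖(u : ℚ_[p])‖ = 1 ∧ W.realPeriodRat = u * plusPeriod f)
    (hint : ∀ r : ℚ, ratPlusSymbol f r ≠ 0 → 0 ≤ padicValRat p (ratPlusSymbol f r))
    (htam : ¬ p ∣ W.tamagawaProduct) (hK : X4.KuriharaUnitAt W p f) : BSDp W p := by
  have hp3 : 3 ≤ p := by
    have h2 := hp.out.two_le
    have hne : p ≠ 2 := hX.1
    omega
  obtain ⟨n, hn0, hn, hcyc, ψ, hψ, hδ⟩ := hK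
  exact (bsdp_iff_not_dvd_tamagawaProduct_of_integralPeriod_OPEN_of_kuriharaUnit W p hK25u hGZK hp3
    htower ((W.analyticRank_eq_zero_iff_holds (hmod W)).mp hr) hf hper hint n hn hcyc ψ hψ hδ).mpr htam

/-! ### §3 The general-rank clause ⟹ the cell's typed predicate `X4.KimShaLengthAt` (RA3 (iii)) -/

/-- **Kim 2025 Thm. 1.1 ("BSD") second clause (OPEN, own currency) ⟹ `X4.KimShaLengthAt W p f`** at
`p ≥ 3` under the tower, `Ш(E/ℚ)` finite, newform `f` of `W` with `Ω⁺_f`-integral plus symbols — one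
line: the body of the OPEN `Prop` IS cc-typer-1's predicate (Kim AJM 148 Thm. 1.8 (6) verbatim core).
CONDITIONAL on the preprint. [claim: Kim2025RefinedTNC, status: under-review]
[cite: Kim2025RefinedTNC, Thm. 1.1 ("BSD") (ANNOUNCED, OPEN binder)] [cite: Kim2022StructureSelmer, Thm. 1.9 (6) (PDF p. 8)] -/
theorem kimShaLengthAt_of_kim2025_OPEN
    (hK25s : Kim2025.thm11_kimShaLength_of_integralPeriod_OPEN)
    (hp3 : 3 ≤ p) (htower : ∀ n : ℕ, W.HasSurjectiveModNGaloisRep (p ^ n : ℕ)) (hfin : Finite W.sha)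
    {N : ℕ} [NeZero N] {f : CuspForm (Gamma0 N) 2} (hf : IsNewformOf W f)
    (hint : ∀ r : ℚ, ratPlusSymbol f r ≠ 0 → 0 ≤ padicValRat p (ratPlusSymbol f r)) :
    X4.KimShaLengthAt W p f :=
  fun r hr => hK25s W p hp3 htower hfin f hf hint r hr

/-- **… and its BSD-currency reading in analytic rank `0`**: for a modular parametrisation datum `D`
(newform `D.f`), `p ≥ 3`, tower (so `E[p]` irreducible), `L(E,1) ≠ 0`, `Ш(E/ℚ)` finite, the period
transfer `Ω(W) = u·Ω⁺_{D.f}` (`|u|_p = 1`) and `Ω⁺_{D.f}`-integral symbols: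
`X4.KimShaLengthRankZeroAt W p D.f` — `L(E,1)/Ω(W) = q`, `∂^{(∞)}(δ̃) = d ∈ ℕ`,
`ord_p q = ord_p #Ш(E/ℚ)(p) + d` (cc-typer-1's `X4.kimShaLengthRankZeroAt_of_kimShaLengthAt`).
CONDITIONAL on the preprint. [claim: Kim2025RefinedTNC, status: under-review]
[cite: Kim2025RefinedTNC, Thm. 1.1 ("BSD"), Cor. 1.7 (ANNOUNCED, OPEN binder)] -/
theorem kimShaLengthRankZeroAt_of_kim2025_OPEN
    (hK25s : Kim2025.thm11_kimShaLength_of_integralPeriod_OPEN)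
    (hp3 : 3 ≤ p) (htower : ∀ n : ℕ, W.HasSurjectiveModNGaloisRep (p ^ n : ℕ))
    (hL : W.entireLFunction 1 ≠ 0) (hfin : Finite W.sha)
    {N : ℕ} [NeZero N] (D : ModularParametrizationData W N)
    (hper : ∃ u : ℚ, ‖(u : ℚ_[p])‖ = 1 ∧ W.realPeriodRat = u * plusPeriod D.f)
    (hint : ∀ r : ℚ, ratPlusSymbol D.f r ≠ 0 → 0 ≤ padicValRat p (ratPlusSymbol D.f r)) :
    X4.KimShaLengthRankZeroAt W p D.f := by
  have hp2 : p ≠ 2 := by omega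
  have hsurj : W.HasSurjectiveModNGaloisRep p := by simpa using htower 1
  exact X4.kimShaLengthRankZeroAt_of_kimShaLengthAt W p hp2
    (hasIrreducibleModPGaloisRep_of_hasSurjectiveModNGaloisRep W p hsurj) hL D hper
    (kimShaLengthAt_of_kim2025_OPEN W p hK25s hp3 htower hfin D.isNewformOf hint)

end Summit.BirchSwinnertonDyer.Rank1Residual.Additive

end
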